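import Mathlib
import Summits.Ventures.PercRepro2.Defs
import Summits.Ventures.PercRepro2.Independence
import Summits.Ventures.PercRepro2.Graph
import Summits.Ventures.PercRepro2.Induced
import Summits.Ventures.PercRepro2.HullDefs
import Summits.Ventures.PercRepro2.HullFlip
import Summits.Ventures.PercRepro2.HullTheoremA
import Summits.Ventures.PercRepro2.HullTree

/-!
# The down-set (Hall) forms of (BASE): rows (DS), (DSK), (CS) (blind cell PercRepro2, typer-1;
lead g10 `LEAD-PROOFSHAPES.md` ADDENDUM 24 (23), (27) (CS), (29) (DSK))

On the free fibre, with `t(ζ) = s_{o,l}(ζ) · 1[h ∉ H_l] · 1[h ↔_B b]` (`sideSign · outConn`), the Hall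
statements of the lead are COUNTING statements over down-sets (Hall's condition for an injection
`M → P` that only moves `(H_l, core)` downwards is exactly "every down-set carries at least as many
`+1` as `−1` configurations"):

* **`DSRow`** (row 2′HULLSHRINK / (DS)): `Σ_{ζ : H_l(ζ) ∈ 𝒟} t(ζ) ≥ 0` for every down-set `𝒟` of vertex
  sets; **`DSKRow`** ((DSK), the sharpest Hall statement found): the same for every down-set of pairs
  `(H_l, core)` in the product order; **`CSRow`** ((CS), core-size partial sums):
  `Σ_{ζ : |core(ζ)| ≤ j} t(ζ) ≥ 0` for every `j`;
* implications `DSRow_of_DSKRow`, `CSRow_of_DSKRow`, `base_of_DSRow` (the whole space is a down-set: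
  (DS) ⟹ (BASE) on the free fibre);
* **`cs_one`** (the `j = 1` layer of (CS) is Theorem B): `|core| ≤ 1 ↔ core = {l}`
  (`core_ncard_le_one_iff`), so `Σ_{|core| ≤ 1} t ≥ 0` is `thmB_conn`; per hull, the `j = 1` layer is
  `coreTrivial_sum_nonneg`.

Census (lead, exact): (DS) 0 Hall failures on all markings `n ≤ 7`; (DSK) 0 / 7,032 (`n = 6`) +
0 / 19,671 (`n = 7` random); (CS) 0 / 29,422 (`n = 6`). The exact layers `|core| = j` and the per-hull
partial sums are NOT nonnegative (NEG-50). Statements only, plus the `j = 1` theorem.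
-/

namespace Summit.Ventures.PercRepro2

namespace Hull

open scoped Classical

variable {V : Type*} {E : Type*} [Fintype E] [DecidableEq E]
  {R : Type*} [Field R] [LinearOrder R] [IsStrictOrderedRing R]

/-! ## The three down-set rows -/

/-- **Row (DS)** (hull-shrinking injection, counting form): for every down-set `𝒟` of vertex sets,
`Σ_{ζ : H_l(ζ) ∈ 𝒟} s_{o,l}(ζ) · 1[h ∉ H_l] · 1[h ↔_B b] ≥ 0`. -/
def DSRow (R : Type*) [Ring R] [LinearOrder R] (ends : E → Sym2 V) (l o h b : V) : Prop :=
  ∀ 𝒟 : Set (Set V), IsLowerSet 𝒟 →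
    0 ≤ ∑ ζ : Config E, if hull ends ζ l ∈ 𝒟 then sideSign R ends ζ l o * outConn R ends l h b ζ else 0

/-- **Row (DSK)** (hull- and core-shrinking injection, counting form): for every down-set `𝒟` of
pairs `(H, K)` of vertex sets (product order), `Σ_{ζ : (H_l, core) ∈ 𝒟} s_{o,l} · 1[h ∉ H_l] · 1[h ↔_B b] ≥ 0`. -/
def DSKRow (R : Type*) [Ring R] [LinearOrder R] (ends : E → Sym2 V) (l o h b : V) : Prop :=
  ∀ 𝒟 : Set (Set V × Set V), IsLowerSet 𝒟 →
    0 ≤ ∑ ζ : Config E, if (hull ends ζ l, core ends ζ l) ∈ 𝒟 then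
      sideSign R ends ζ l o * outConn R ends l h b ζ else 0

/-- **Row (CS)** (core-size partial sums): for every `j`,
`Σ_{ζ : |core(ζ)| ≤ j} s_{o,l} · 1[h ∉ H_l] · 1[h ↔_B b] ≥ 0`. -/
def CSRow (R : Type*) [Ring R] [LinearOrder R] (ends : E → Sym2 V) (l o h b : V) : Prop :=
  ∀ j : ℕ, 0 ≤ ∑ ζ : Config E, if (core ends ζ l).ncard ≤ j then
    sideSign R ends ζ l o * outConn R ends l h b ζ else 0

/-! ## Implications -/

omit [IsStrictOrderedRing R] in
/-- (DSK) ⟹ (DS): a down-set of hulls is a down-set of pairs through the first coordinate. -/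
theorem DSRow_of_DSKRow (ends : E → Sym2 V) (l o h b : V) (hd : DSKRow R ends l o h b) :
    DSRow R ends l o h b := by
  intro 𝒟 h𝒟
  refine (hd {HK | HK.1 ∈ 𝒟} (fun _ _ hle hmem => h𝒟 hle.1 hmem)).trans
    (le_of_eq (Finset.sum_congr rfl fun ζ _ => ?_))
  by_cases hH : hull ends ζ l ∈ 𝒟 <;> simp [hH]

omit [IsStrictOrderedRing R] in
/-- (DSK) ⟹ (CS): `{(H, K) ∣ |K| ≤ j}` is a down-set of pairs (on a finite vertex type). -/
theorem CSRow_of_DSKRow [Fintype V] (ends : E → Sym2 V) (l o h b : V)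
    (hd : DSKRow R ends l o h b) : CSRow R ends l o h b := by
  intro j
  refine (hd {HK | HK.2.ncard ≤ j}
    (fun _ _ hle hmem => (Set.ncard_le_ncard hle.2 (Set.toFinite _)).trans hmem)).trans
    (le_of_eq (Finset.sum_congr rfl fun ζ _ => ?_))
  by_cases hj : (core ends ζ l).ncard ≤ j <;> simp [hj]

omit [IsStrictOrderedRing R] in
/-- (DS) ⟹ (BASE) on the free fibre (the whole space is a down-set). -/
theorem base_of_DSRow (ends : E → Sym2 V) (l o h b : V) (hd : DSRow R ends l o h b) :
    0 ≤ ∑ ζ : Config E, sideSign R ends ζ l o * outConn R ends l h b ζ := by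
  refine (hd Set.univ (fun _ _ _ _ => Set.mem_univ _)).trans
    (le_of_eq (Finset.sum_congr rfl fun ζ _ => ?_))
  simp

/-! ## The `j = 1` layer of (CS) -/

omit [Fintype E] [DecidableEq E] [Field R] [LinearOrder R] [IsStrictOrderedRing R] in
/-- The core has at most one element iff it is `{l}` (on a finite vertex type). -/
lemma core_ncard_le_one_iff [Fintype V] (ends : E → Sym2 V) (ζ : Config E) (l : V) :
    (core ends ζ l).ncard ≤ 1 ↔ core ends ζ l = {l} := by
  rw [Set.ncard_le_one_iff (Set.toFinite _)]
  constructor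
  · intro h
    ext k
    constructor
    · intro hk
      exact h hk (l_mem_core ζ l)
    · intro hk
      rw [Set.mem_singleton_iff] at hk
      subst hk
      exact l_mem_core ζ k
  · intro h x y hx hy
    rw [h, Set.mem_singleton_iff] at hx hy
    rw [hx, hy]

/-- **The `j = 1` layer of (CS) is Theorem B**: `Σ_{|core| ≤ 1} s_{o,l} · 1[h ∉ H_l] · 1[h ↔_B b] ≥ 0`. -/
theorem cs_one [Fintype V] (ends : E → Sym2 V) (l o h b : V) :
    0 ≤ ∑ ζ : Config E, if (core ends ζ l).ncard ≤ 1 then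
      sideSign R ends ζ l o * outConn R ends l h b ζ else 0 := by
  refine (thmB_conn (R := R) ends l o h b).trans (le_of_eq (Finset.sum_congr rfl fun ζ _ => ?_))
  by_cases hK : core ends ζ l = {l}
  · simp [hK]
  · have h1 : ¬ (core ends ζ l).ncard ≤ 1 := fun h => hK ((core_ncard_le_one_iff ends ζ l).1 h)
    simp [hK, h1]

/-- The per-hull `j = 1` layer is `coreTrivial_sum_nonneg`. -/
theorem cs_one_hull [Fintype V] (ends : E → Sym2 V) (l o h b : V) (H : Set V) :
    0 ≤ ∑ ζ : Config E, if hull ends ζ l = H ∧ (core ends ζ l).ncard ≤ 1 then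
      sideSign R ends ζ l o * outConn R ends l h b ζ else 0 := by
  refine (coreTrivial_sum_nonneg (R := R) ends l o h b H).trans
    (le_of_eq (Finset.sum_congr rfl fun ζ _ => ?_))
  by_cases hK : core ends ζ l = {l}
  · simp [hK]
  · have h1 : ¬ (core ends ζ l).ncard ≤ 1 := fun h => hK ((core_ncard_le_one_iff ends ζ l).1 h)
    simp [hK, h1]

end Hull

end Summit.Ventures.PercRepro2
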